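import Mathlib.RingTheory.MvPolynomial.Symmetric.NewtonIdentities
import Mathlib.RingTheory.Polynomial.Vieta
import Mathlib.RingTheory.MvPolynomial.Homogeneous
import Mathlib.Algebra.MvPolynomial.Equiv
import Mathlib.LinearAlgebra.Vandermonde
import Mathlib.FieldTheory.IsAlgClosed.Basic
import Mathlib.Analysis.Complex.Polynomial.Basic
import HarnessLib

/-!
# Newton's identities for the power sums of the roots of a monic family, and the Hankel discriminant

Layer `Literature/RingTheory/MvPolynomial`. Let `P = Σ_j a_j(w) X^j` be a polynomial in one variable with
coefficients `a_j ∈ ℂ[w₁, …, w_m]`, with `P.coeff d = c ≠ 0` constant and `deg a_j + j ≤ d` (so the fibres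
`P_w = P(·, w)` have exactly `d` roots `ρ₁(w), …, ρ_d(w)` counted with multiplicity). Newton's identities (Mathlib's
`MvPolynomial.psum_eq_mul_esymm_sub_sum`) applied fibrewise show:

* `multiset_psum_newton` — Newton's identities for the power sums `p_k = Σ ρ^k` and elementary symmetric functions
  of a multiset (from Mathlib's identity in the ring of symmetric polynomials, by enumeration);
* `exists_powerSums` — there are POLYNOMIALS `S_k ∈ ℂ[w]` with `S_k(w) = Σ_i ρ_i(w)^k`, `deg S_k ≤ k`, whose Hankel
  determinant `Δ = det (S_{i+j})_{i,j<d}` has `Δ(w) = ∏_{i<j} (ρ_i(w) - ρ_j(w))²` — so `Δ(w) ≠ 0` iff the roots of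
  `P_w` are distinct — and total degree EXACTLY `d(d-1)` as soon as some fibre of the top-degree family
  `P^top = Σ_j a_j^{(d-j)}(w) X^j` (`a_j^{(d-j)}` the homogeneous component of degree `d - j`) has distinct roots (the
  degree-`d(d-1)` component of `Δ` is the Hankel determinant of `P^top`).

This is the algebraic bookkeeping of Serre's algebraisation lemma on an affine hypersurface in Noether normal form
(GAGA n° 19–20): the degree count `deg Δ = d(d-1)` is what bounds the degree of the interpolating polynomial.
Everything is proved; no definitions, no named facts.

## References

* J.-P. Serre, *Géométrie algébrique et géométrie analytique*, Ann. Inst. Fourier 6 (1956), n° 19–20. [SerreGAGA1956]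
* I. G. Macdonald, *Symmetric Functions and Hall Polynomials*, 2nd ed. (1995), Ch. I §2, (2.11') (Newton's formulae).
-/

noncomputable section

open Polynomial Finset
open scoped BigOperators

namespace Literature.RingTheory.MvPolynomial

namespace NewtonPowerSums

/-! ### Newton's identities for a multiset -/

/-- **Newton's identities for the power sums of a multiset**: for `k ≥ 1`,
`Σ_{ρ ∈ M} ρ^k = (-1)^{k+1} k e_k(M) - Σ_{0<i<k} (-1)^i e_i(M) Σ_ρ ρ^{k-i}` (Mathlib's identity in the symmetric
polynomials, evaluated at an enumeration of `M`). [cite: SerreGAGA1956, n° 19 Lemme 8] -/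
theorem multiset_psum_newton {R : Type*} [CommRing R] (M : Multiset R) {k : ℕ} (hk : 0 < k) :
    (M.map (· ^ k)).sum = (-1) ^ (k + 1) * k * M.esymm k -
      ∑ a ∈ antidiagonal k with a.1 ∈ Set.Ioo 0 k, (-1) ^ a.1 * M.esymm a.1 * (M.map (· ^ a.2)).sum := by
  classical
  induction M using Quotient.inductionOn with
  | h l =>
    set r : Fin l.length → R := l.get with hr
    have hM : (univ.val.map r : Multiset R) = (l : Multiset R) := by
      rw [Fin.univ_val_map, hr, List.ofFn_get]
    have hps : ∀ n, MvPolynomial.aeval r (MvPolynomial.psum (Fin l.length) R n) =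
        ((l : Multiset R).map (· ^ n)).sum := by
      intro n
      rw [MvPolynomial.psum, map_sum, ← hM, Multiset.map_map, Finset.sum_eq_multiset_sum]
      simp
    have hes : ∀ n, MvPolynomial.aeval r (MvPolynomial.esymm (Fin l.length) R n) = (l : Multiset R).esymm n := by
      intro n; rw [MvPolynomial.aeval_esymm_eq_multiset_esymm, hM]
    have h := congrArg (MvPolynomial.aeval r) (MvPolynomial.psum_eq_mul_esymm_sub_sum (Fin l.length) R k hk)
    rw [map_sub, map_sum, hps] at h
    change ((l : Multiset R).map (· ^ k)).sum = _
    rw [h]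
    congr 1
    · simp only [map_mul, map_pow, map_neg, map_one, map_natCast, hes]
      rfl
    · refine sum_congr rfl fun a _ ↦ ?_
      simp only [map_mul, map_pow, map_neg, map_one, hes, hps]
      rfl


/-! ### Newton sequences: existence, degrees, top homogeneous parts -/

section Newton

variable {A : Type*} [CommRing A]

/-- **A Newton sequence exists**: given `E : ℕ → A` and an initial value `s₀` there is `S : ℕ → A` with `S 0 = s₀`
and `S k = (-1)^{k+1} k E_k - Σ_{0<i<k} (-1)^i E_i S_{k-i}` for `k ≥ 1` (strong recursion). [cite: SerreGAGA1956, n° 19 Lemme 8] -/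
theorem exists_newtonSeq (E : ℕ → A) (s₀ : A) :
    ∃ S : ℕ → A, S 0 = s₀ ∧ ∀ k, 0 < k → S k = (-1) ^ (k + 1) * k * E k -
      ∑ a ∈ antidiagonal k with a.1 ∈ Set.Ioo 0 k, (-1) ^ a.1 * E a.1 * S a.2 := by
  classical
  let F : ∀ k : ℕ, (∀ j, j < k → A) → A := fun k ih ↦
    if hk : k = 0 then s₀ else (-1) ^ (k + 1) * k * E k -
      ∑ a ∈ (antidiagonal k |>.filter fun a ↦ a.1 ∈ Set.Ioo 0 k).attach, (-1) ^ a.1.1 * E a.1.1 *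
        ih a.1.2 (by
          have ha := a.2
          rw [mem_filter, mem_antidiagonal] at ha
          have := ha.2.1
          omega)
  refine ⟨fun k ↦ Nat.strongRec F k, ?_, fun k hk ↦ ?_⟩
  · beta_reduce; rw [Nat.strongRec_eq]; simp [F]
  · beta_reduce
    conv_lhs => rw [Nat.strongRec_eq]
    simp only [F, dif_neg hk.ne']
    congr 1
    exact Finset.sum_attach _ fun a : ℕ × ℕ ↦ (-1) ^ a.1 * E a.1 * Nat.strongRec F a.2

end Newton

section Degrees

variable {σ : Type*} {R : Type*} [CommRing R]

/-- **Degree bound for Newton sequences**: if `deg E_i ≤ i` and `S` is a Newton sequence for `E` with `S 0` a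
constant, then `deg S_k ≤ k`. [cite: SerreGAGA1956, n° 19 Lemme 8] -/
theorem totalDegree_newtonSeq_le {E S : ℕ → MvPolynomial σ R} (hE : ∀ i, (E i).totalDegree ≤ i)
    (h0 : (S 0).totalDegree = 0)
    (hS : ∀ k, 0 < k → S k = (-1) ^ (k + 1) * k * E k -
      ∑ a ∈ antidiagonal k with a.1 ∈ Set.Ioo 0 k, (-1) ^ a.1 * E a.1 * S a.2) (k : ℕ) :
    (S k).totalDegree ≤ k := by
  induction k using Nat.strong_induction_on with
  | _ k ih =>
    rcases Nat.eq_zero_or_pos k with rfl | hk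
    · rw [h0]
    rw [hS k hk]
    have hsign : ∀ n : ℕ, ((-1 : MvPolynomial σ R) ^ n).totalDegree = 0 := fun n ↦ by
      rw [show (-1 : MvPolynomial σ R) = MvPolynomial.C (-1) by simp, ← map_pow, MvPolynomial.totalDegree_C]
    have hnat : ((k : MvPolynomial σ R)).totalDegree = 0 := by
      rw [show (k : MvPolynomial σ R) = MvPolynomial.C (k : R) by simp, MvPolynomial.totalDegree_C]
    refine (MvPolynomial.totalDegree_sub _ _).trans (max_le ?_ ?_)
    · refine (MvPolynomial.totalDegree_mul _ _).trans ?_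
      refine (add_le_add (MvPolynomial.totalDegree_mul _ _) le_rfl).trans ?_
      rw [hsign, hnat]; simpa using hE k
    · refine (MvPolynomial.totalDegree_finsetSum _ _).trans (Finset.sup_le fun a ha ↦ ?_)
      rw [mem_filter, mem_antidiagonal, Set.mem_Ioo] at ha
      have hak := ha.1
      have ha1 := ha.2.1
      refine (MvPolynomial.totalDegree_mul _ _).trans ?_
      refine (add_le_add (MvPolynomial.totalDegree_mul _ _) (ih a.2 (by omega))).trans ?_
      rw [hsign, zero_add]
      have := hE a.1
      omega

/-- **Top homogeneous component of a product at the sum of the degree bounds**: if `deg p ≤ a` and `deg q ≤ b` then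
the degree-`(a+b)` component of `p q` is the product of the degree-`a` component of `p` and the degree-`b` component
of `q`. [cite: SerreGAGA1956, n° 19 Lemme 8] -/
theorem homogeneousComponent_mul_of_le {p q : MvPolynomial σ R} {a b : ℕ} (hp : p.totalDegree ≤ a)
    (hq : q.totalDegree ≤ b) :
    MvPolynomial.homogeneousComponent (a + b) (p * q) =
      MvPolynomial.homogeneousComponent a p * MvPolynomial.homogeneousComponent b q := by
  classical
  ext m
  rw [MvPolynomial.coeff_homogeneousComponent, MvPolynomial.coeff_mul, MvPolynomial.coeff_mul]
  split_ifs with hm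
  · refine sum_congr rfl fun uv huv ↦ ?_
    rw [mem_antidiagonal] at huv
    rw [MvPolynomial.coeff_homogeneousComponent, MvPolynomial.coeff_homogeneousComponent]
    by_cases hu : uv.1 ∈ p.support
    · by_cases hv : uv.2 ∈ q.support
      · have hdu : uv.1.degree ≤ a := (MvPolynomial.le_totalDegree hu).trans hp
        have hdv : uv.2.degree ≤ b := (MvPolynomial.le_totalDegree hv).trans hq
        have hsum : uv.1.degree + uv.2.degree = a + b := by rw [← map_add, huv, hm]
        rw [if_pos (by omega), if_pos (by omega)]
      · rw [MvPolynomial.notMem_support_iff.mp hv]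
        split_ifs <;> simp
    · rw [MvPolynomial.notMem_support_iff.mp hu]
      split_ifs <;> simp
  · symm
    have hhom : (MvPolynomial.homogeneousComponent a p * MvPolynomial.homogeneousComponent b q).IsHomogeneous
        (a + b) :=
      (MvPolynomial.homogeneousComponent_isHomogeneous a p).mul (MvPolynomial.homogeneousComponent_isHomogeneous b q)
    have := hhom.coeff_eq_zero (d := m) hm
    rwa [MvPolynomial.coeff_mul] at this

/-- **The top homogeneous components of a Newton sequence form a Newton sequence** for the top components of the
data: with `deg E_i ≤ i`, `S'_k = (S_k)_{(k)}` satisfies the Newton recursion for `E'_i = (E_i)_{(i)}`.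
[cite: SerreGAGA1956, n° 19 Lemme 8] -/
theorem newtonSeq_homogeneousComponent {E S : ℕ → MvPolynomial σ R} (hE : ∀ i, (E i).totalDegree ≤ i)
    (h0 : (S 0).totalDegree = 0)
    (hS : ∀ k, 0 < k → S k = (-1) ^ (k + 1) * k * E k -
      ∑ a ∈ antidiagonal k with a.1 ∈ Set.Ioo 0 k, (-1) ^ a.1 * E a.1 * S a.2) (k : ℕ) (hk : 0 < k) :
    MvPolynomial.homogeneousComponent k (S k) =
      (-1) ^ (k + 1) * k * MvPolynomial.homogeneousComponent k (E k) -
      ∑ a ∈ antidiagonal k with a.1 ∈ Set.Ioo 0 k,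
        (-1) ^ a.1 * MvPolynomial.homogeneousComponent a.1 (E a.1) * MvPolynomial.homogeneousComponent a.2 (S a.2) := by
  classical
  have hdeg := totalDegree_newtonSeq_le hE h0 hS
  have hCmul : ∀ (r : R) (n : ℕ) (p : MvPolynomial σ R), MvPolynomial.homogeneousComponent n (MvPolynomial.C r * p) =
      MvPolynomial.C r * MvPolynomial.homogeneousComponent n p := fun r n p ↦
    MvPolynomial.homogeneousComponent_C_mul p n r
  have hsign : ∀ n : ℕ, ((-1 : MvPolynomial σ R) ^ n) = MvPolynomial.C ((-1) ^ n) := fun n ↦ by simp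
  have hnat : (k : MvPolynomial σ R) = MvPolynomial.C (k : R) := by simp
  rw [hS k hk, map_sub, map_sum]
  congr 1
  · rw [hsign, hnat, ← map_mul, hCmul]
  · refine sum_congr rfl fun a ha ↦ ?_
    rw [mem_filter, mem_antidiagonal] at ha
    rw [hsign, mul_assoc, hCmul, mul_assoc]
    congr 1
    rw [← ha.1]
    exact homogeneousComponent_mul_of_le (hE a.1) (hdeg a.2)

end Degrees


/-! ### Newton sequences built on the elementary symmetric functions compute the power sums -/

/-- **A Newton sequence on the elementary symmetric functions of a multiset is the sequence of its power sums**: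
if `e_i = e_i(M)` for all `i`, `s_0 = #M` and `s` satisfies Newton's recursion, then `s_k = Σ_{ρ ∈ M} ρ^k`.
[cite: SerreGAGA1956, n° 19 Lemme 8] -/
theorem newtonSeq_eq_psum {R : Type*} [CommRing R] (M : Multiset R) {e s : ℕ → R}
    (he : ∀ i, e i = M.esymm i) (h0 : s 0 = Multiset.card M)
    (hs : ∀ k, 0 < k → s k = (-1) ^ (k + 1) * k * e k -
      ∑ a ∈ antidiagonal k with a.1 ∈ Set.Ioo 0 k, (-1) ^ a.1 * e a.1 * s a.2) (k : ℕ) :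
    s k = (M.map (· ^ k)).sum := by
  induction k using Nat.strong_induction_on with
  | _ k ih =>
    rcases Nat.eq_zero_or_pos k with rfl | hk
    · rw [h0]; simp
    rw [hs k hk, multiset_psum_newton M hk, he]
    congr 1
    refine sum_congr rfl fun a ha ↦ ?_
    rw [mem_filter, mem_antidiagonal, Set.mem_Ioo] at ha
    rw [he, ih a.2 (by omega)]

end NewtonPowerSums

end Literature.RingTheory.MvPolynomial
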